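import Mathlib
import HarnessLib
import Literature.Analysis.FluidPDE.SereginSverak2002RadialZoomLimit
import Summits.NavierStokesRegularity.NavierStokesRegularity.Theorems.QuarterLogPincerTypeIQuantSubcubicExpZoomEnergyLimit

/-!
# Crux `QuarterLogPincer.TypeIQuantSubcubicExp` (stmt-NavierStokesRegularity-24077), line `thin_cascade`:
  the final-time trace of the zooms — a weak `L²_loc` limit `g` along a subsequence (clause (4))

Helper file (`--supports stmt-NavierStokesRegularity-24077 --as helper`, lead prover ns-tc-p1 g3) toward
the registered stub `stub_thinObjectExtraction` (S2, skeleton v5), trace block.  The final slices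
`v_K(0) = ρ_K u_K(T_K, x₀^K + ρ_K ·)` of the zooms of cheap cascades are bounded in `L²` on every ball,
uniformly (`A`-clause of the proved stub `UniformScaledEnergy` at the final vertex:
`∫_{B(0,r)} |v_K(0)|² ≤ C r` for `r ≤ e^K`).  Truncating to `B(0, e^K)` and weighting by
`(1 + |y|²)⁻¹` (the device of the tree's `SereginSverak2002RadialZoomLimit`) gives a bounded sequence in
the Hilbert space `L²(ℝ³; ℝ³)`, hence a weakly convergent subsequence
(`FunctionSpaces.exists_strictMono_tendsto_inner_of_norm_le`); unweighting the limit gives the trace: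

* `exists_traceLimit_of_cheapCascades` — along a further subsequence `ψ`, a locally integrable
  `g : ℝ³ → ℝ³` (square integrable on every ball) with
  `∫⟪v_{φ(ψ k)}(0), ζ⟫ → ∫⟪g, ζ⟫` for every compactly supported `ζ ∈ L²` — clause (4) of
  `ThinObject` and the final-time half of clause (5).

HONEST FRAMING: bookkeeping toward one registered stub of an open crux; nothing about Navier–Stokes
regularity is proved; no summit statement is proved by this file.
-/

noncomputable section

-- the summit-side namespace `Summit.NavierStokesRegularity.NavierStokesRegularity.…` (single-conjunct summit,
-- D-0017) repeats a component by design; the dupNamespace linter would flag every declaration.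
set_option linter.dupNamespace false

namespace Summit.NavierStokesRegularity.NavierStokesRegularity.Theorems.ThinCascade

open MeasureTheory Set Function Metric Filter Topology
open scoped ENNReal NNReal InnerProductSpace RealInnerProductSpace
open Literature.Analysis Literature.Analysis.FluidPDE
open Summit.NavierStokesRegularity.NavierStokesRegularity.Cruxes.TypeIQuantSubcubicExp.ThinCascade
  (TaoFrame CheapCascade SingularAt UniformScaledEnergy stub_uniformScaledEnergy)

/-- **The final slice of the zoom has `∫_{B(0,r)} |v(0)|² ≤ C r` for `r ≤ e^K`** (the `A`-clause of
`UniformScaledEnergy` at the final vertex `(T, x₀)`, radius `ρr`). [folklore] -/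
theorem lintegral_sq_ball_zoom_zero_le {M C T τ ρ : ℝ} {K : ℕ} (x₀ : EuclideanSpace ℝ (Fin 3))
    {u : ℝ → EuclideanSpace ℝ (Fin 3) → EuclideanSpace ℝ (Fin 3)} {p : ℝ → EuclideanSpace ℝ (Fin 3) → ℝ}
    (hC : ∀ (T τ : ℝ) (u : ℝ → EuclideanSpace ℝ (Fin 3) → EuclideanSpace ℝ (Fin 3))
      (p : ℝ → EuclideanSpace ℝ (Fin 3) → ℝ), TaoFrame T u p → 0 < τ →
      (∀ t ∈ Icc 0 T, ∀ x : EuclideanSpace ℝ (Fin 3), ‖u t x‖ ≤ M * (T + τ - t) ^ (-(1 / 2 : ℝ))) →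
      ∀ (x : EuclideanSpace ℝ (Fin 3)) (r : ℝ), 0 < r → r ^ 2 ≤ T →
        (∀ t ∈ Icc (T - r ^ 2) T,
          ∫⁻ y in ball x r, ENNReal.ofReal (‖u t y‖ ^ 2) ≤ ENNReal.ofReal (C * r)) ∧
        (∫⁻ t in Icc (T - r ^ 2) T, ∫⁻ y in ball x r,
          ENNReal.ofReal (‖fderiv ℝ (u t) y‖ ^ 2) ≤ ENNReal.ofReal (C * r)) ∧
        (∫⁻ t in Icc (T - r ^ 2) T, ∫⁻ y in ball x r,
          ENNReal.ofReal (|p t y - ⨍ z in ball x r, p t z| ^ (3 / 2 : ℝ)) ≤ ENNReal.ofReal (C * r ^ 2)))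
    (hfr : TaoFrame T u p) (hτ : 0 < τ) (hρ : 0 < ρ) (hlife : Real.exp (2 * K) * ρ ^ 2 ≤ T)
    (hrate : ∀ t ∈ Icc 0 T, ∀ x : EuclideanSpace ℝ (Fin 3), ‖u t x‖ ≤ M * (T + τ - t) ^ (-(1 / 2 : ℝ)))
    {r : ℝ} (hr : 0 < r) (hrK : r ≤ Real.exp K) :
    ∫⁻ y in ball (0 : EuclideanSpace ℝ (Fin 3)) r, ‖(ρ • stPull (ρ ^ 2) ρ T x₀ u) 0 y‖ₑ ^ 2 ≤
      ENNReal.ofReal (C * r) := by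
  have hρ2 : 0 < ρ ^ 2 := by positivity
  have hRT : (ρ * r) ^ 2 ≤ T := by
    have h1 : r ^ 2 ≤ Real.exp K ^ 2 := pow_le_pow_left₀ hr.le hrK 2
    have h2 : Real.exp K ^ 2 = Real.exp (2 * K) := by rw [← Real.exp_nat_mul]; norm_num
    nlinarith [mul_le_mul_of_nonneg_left (h2 ▸ h1) hρ2.le]
  obtain ⟨hA, -, -⟩ := hC T τ u p hfr hτ hrate (x₀ + ρ • (0 : EuclideanSpace ℝ (Fin 3))) (ρ * r)
    (by positivity) hRT
  have hT0 : 0 ≤ T := le_trans (by positivity) hlife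
  have h1 := hA T ⟨by nlinarith [sq_nonneg (ρ * r)], le_rfl⟩
  rw [lintegral_sq_ball_zoom hρ T x₀ u 0 0 r, mul_zero, add_zero]
  have h2 : ∫⁻ x in ball (x₀ + ρ • (0 : EuclideanSpace ℝ (Fin 3))) (ρ * r), ‖u T x‖ₑ ^ 2 ≤
      ENNReal.ofReal (C * (ρ * r)) := by
    refine le_trans (le_of_eq (lintegral_congr fun x => ?_)) h1
    rw [← ofReal_norm, ENNReal.ofReal_pow (norm_nonneg _)]
  calc (ENNReal.ofReal ρ)⁻¹ * ∫⁻ x in ball (x₀ + ρ • (0 : EuclideanSpace ℝ (Fin 3))) (ρ * r), ‖u T x‖ₑ ^ 2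
      ≤ (ENNReal.ofReal ρ)⁻¹ * ENNReal.ofReal (C * (ρ * r)) := mul_le_mul' le_rfl h2
    _ = ENNReal.ofReal (C * r) := by
        rw [← ENNReal.ofReal_inv_of_pos hρ, ← ENNReal.ofReal_mul (by positivity)]
        congr 1
        field_simp

/-- **The final-time trace of the zooms of cheap cascades (weak `L²_loc` limit along a
subsequence).**  In the setting of `exists_typeIAncientMild_zoomLimit_of_cheapCascades` there are a
strictly increasing `ψ` and a locally integrable field `g`, square integrable on every ball, such that
`∫⟪v_{φ(ψ k)}(0, ·), ζ⟫ → ∫⟪g, ζ⟫` for every `ζ ∈ L²` vanishing off a ball, where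
`v_K = ρ_K • stPull (ρ_K²) ρ_K T_K x₀^K u_K` are the zooms.  (Truncation to `B(0,e^K)`, weight
`(1+|y|²)⁻¹`, weak compactness in `L²`.) [folklore] -/
theorem exists_traceLimit_of_cheapCascades {M q : ℝ} {T τ ρ : ℕ → ℝ}
    {x₀ : ℕ → EuclideanSpace ℝ (Fin 3)}
    {u : ℕ → ℝ → EuclideanSpace ℝ (Fin 3) → EuclideanSpace ℝ (Fin 3)}
    {p : ℕ → ℝ → EuclideanSpace ℝ (Fin 3) → ℝ}
    (hdata : ∀ K : ℕ, TaoFrame (T K) (u K) (p K) ∧ 0 < τ K ∧ 0 < ρ K ∧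
        Real.exp (2 * K) * ρ K ^ 2 ≤ T K ∧
        τ K ≤ M ^ 2 * Real.exp (-2 * (K : ℝ)) * ρ K ^ 2 ∧
        (∀ t ∈ Icc 0 (T K), ∀ x : EuclideanSpace ℝ (Fin 3),
          ‖u K t x‖ ≤ M * (T K + τ K - t) ^ (-(1 / 2 : ℝ))) ∧
        Real.exp K ≤ ρ K * ‖u K (T K) (x₀ K)‖ ∧
        ∀ j : ℕ, 1 ≤ j → j ≤ K →
          ∫⁻ x in {x : EuclideanSpace ℝ (Fin 3) | ρ K < ‖x - x₀ K‖ ∧ ‖x - x₀ K‖ < Real.exp j * ρ K},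
              ENNReal.ofReal (‖u K (T K) x‖ ^ 3) ≤ ENNReal.ofReal (q * j))
    {φ : ℕ → ℕ} (hφ : StrictMono φ) :
    ∃ (ψ : ℕ → ℕ) (g : EuclideanSpace ℝ (Fin 3) → EuclideanSpace ℝ (Fin 3)), StrictMono ψ ∧
      LocallyIntegrable g volume ∧
      (∀ a : ℝ, IntegrableOn (fun y => ‖g y‖ ^ 2) (ball (0 : EuclideanSpace ℝ (Fin 3)) a) volume) ∧
      ∀ (ζ : EuclideanSpace ℝ (Fin 3) → EuclideanSpace ℝ (Fin 3)), MemLp ζ 2 volume → ∀ (a : ℝ),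
        (∀ y, y ∉ ball (0 : EuclideanSpace ℝ (Fin 3)) a → ζ y = 0) →
        Tendsto (fun k => ∫ y, ⟪((ρ (φ (ψ k))) • stPull (ρ (φ (ψ k)) ^ 2) (ρ (φ (ψ k))) (T (φ (ψ k)))
          (x₀ (φ (ψ k))) (u (φ (ψ k)))) 0 y, ζ y⟫) atTop (𝓝 (∫ y, ⟪g y, ζ y⟫)) := by
  obtain ⟨C, hC⟩ := stub_uniformScaledEnergy M
  set M' : ℝ := max C 0 with hM'
  have hM'0 : 0 ≤ M' := le_max_right _ _
  have hCM' : C ≤ M' := le_max_left _ _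
  -- the final slices of the zooms along `φ`, truncated to `B(0, e^{φ k})`
  set v0 : ℕ → EuclideanSpace ℝ (Fin 3) → EuclideanSpace ℝ (Fin 3) := fun k =>
    ((ρ (φ k)) • stPull (ρ (φ k) ^ 2) (ρ (φ k)) (T (φ k)) (x₀ (φ k)) (u (φ k))) 0 with hv0
  set V : ℕ → EuclideanSpace ℝ (Fin 3) → EuclideanSpace ℝ (Fin 3) := fun k =>
    (ball (0 : EuclideanSpace ℝ (Fin 3)) (Real.exp (φ k))).indicator (v0 k) with hV
  -- continuity / measurability of the final slices
  have hv0c : ∀ k, Continuous (v0 k) := by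
    intro k
    have hcl := (hdata (φ k)).1.1
    have hT : T (φ k) ∈ Icc 0 (T (φ k)) :=
      ⟨le_trans (by positivity) (hdata (φ k)).2.2.2.1, le_rfl⟩
    have huc : Continuous (u (φ k) (T (φ k))) := (hcl.contDiff_velocity hT).continuous
    have e : v0 k = fun y => (ρ (φ k)) • u (φ k) (T (φ k) + ρ (φ k) ^ 2 * 0) (x₀ (φ k) + (ρ (φ k)) • y) := by
      funext y; simp only [hv0, smul_stPull_apply]
    rw [e, mul_zero, add_zero]
    have hlin : Continuous fun y : EuclideanSpace ℝ (Fin 3) => x₀ (φ k) + (ρ (φ k)) • y :=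
      continuous_const.add (continuous_id.const_smul (ρ (φ k)))
    exact (huc.comp hlin).const_smul (ρ (φ k))
  have hVm : ∀ k, AEStronglyMeasurable (V k) volume := fun k =>
    ((hv0c k).aestronglyMeasurable).indicator measurableSet_ball
  -- Morrey bound for the truncated slices at every radius
  have hVball : ∀ k, ∀ r, 0 < r → ∫⁻ y in ball (0 : EuclideanSpace ℝ (Fin 3)) r, ‖V k y‖ₑ ^ 2 ≤
      ENNReal.ofReal (M' * r) := by
    intro k r hr
    have hd := hdata (φ k)
    have hslice : ∀ r', 0 < r' → r' ≤ Real.exp (φ k : ℕ) →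
        ∫⁻ y in ball (0 : EuclideanSpace ℝ (Fin 3)) r', ‖v0 k y‖ₑ ^ 2 ≤ ENNReal.ofReal (M' * r') := by
      intro r' hr' hr'K
      refine (lintegral_sq_ball_zoom_zero_le (x₀ (φ k)) hC hd.1 hd.2.1 hd.2.2.1 hd.2.2.2.1
        hd.2.2.2.2.2.1 hr' hr'K).trans (ENNReal.ofReal_le_ofReal ?_)
      exact mul_le_mul_of_nonneg_right hCM' hr'.le
    -- `‖V‖² = 1_{B(0,e^K)} ‖v0‖²`
    have hVsq : ∀ y, ‖V k y‖ₑ ^ 2 =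
        (ball (0 : EuclideanSpace ℝ (Fin 3)) (Real.exp (φ k))).indicator (fun y => ‖v0 k y‖ₑ ^ 2) y := by
      intro y
      simp only [hV]
      by_cases hy : y ∈ ball (0 : EuclideanSpace ℝ (Fin 3)) (Real.exp (φ k))
      · rw [indicator_of_mem hy, indicator_of_mem hy]
      · rw [indicator_of_notMem hy, indicator_of_notMem hy, enorm_zero, zero_pow two_ne_zero]
    simp_rw [hVsq]
    rw [lintegral_indicator measurableSet_ball, Measure.restrict_restrict measurableSet_ball]
    rcases le_or_gt r (Real.exp (φ k)) with hle | hlt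
    · calc ∫⁻ y in ball (0 : EuclideanSpace ℝ (Fin 3)) (Real.exp (φ k)) ∩ ball 0 r, ‖v0 k y‖ₑ ^ 2
          ≤ ∫⁻ y in ball (0 : EuclideanSpace ℝ (Fin 3)) r, ‖v0 k y‖ₑ ^ 2 :=
            lintegral_mono_set inter_subset_right
        _ ≤ ENNReal.ofReal (M' * r) := hslice r hr hle
    · calc ∫⁻ y in ball (0 : EuclideanSpace ℝ (Fin 3)) (Real.exp (φ k)) ∩ ball 0 r, ‖v0 k y‖ₑ ^ 2
          ≤ ∫⁻ y in ball (0 : EuclideanSpace ℝ (Fin 3)) (Real.exp (φ k)), ‖v0 k y‖ₑ ^ 2 :=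
            lintegral_mono_set inter_subset_left
        _ ≤ ENNReal.ofReal (M' * Real.exp (φ k)) := hslice _ (Real.exp_pos _) le_rfl
        _ ≤ ENNReal.ofReal (M' * r) := ENNReal.ofReal_le_ofReal (mul_le_mul_of_nonneg_left hlt.le hM'0)
  -- the weighted classes in `L²`
  set W : ℕ → EuclideanSpace ℝ (Fin 3) → EuclideanSpace ℝ (Fin 3) :=
    fun k y => ((1 + ‖y‖ ^ 2)⁻¹ : ℝ) • V k y with hWdef
  have hwc : Continuous fun y : EuclideanSpace ℝ (Fin 3) => ((1 + ‖y‖ ^ 2)⁻¹ : ℝ) :=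
    (by fun_prop : Continuous fun y : EuclideanSpace ℝ (Fin 3) => ((1 + ‖y‖ ^ 2) : ℝ)).inv₀
      fun y => (add_pos_of_pos_of_nonneg one_pos (sq_nonneg ‖y‖)).ne'
  have hWm : ∀ k, AEStronglyMeasurable (W k) volume := fun k => hwc.aestronglyMeasurable.smul (hVm k)
  have hWlin : ∀ k, ∫⁻ y, ‖W k y‖ₑ ^ 2 ≤ ENNReal.ofReal (4 * M') := fun k =>
    SereginSverak2002.lintegral_weight_norm_sq_le hM'0 (hVball k)
  have hWnorm : ∀ k, eLpNorm (W k) 2 volume ≤ ENNReal.ofReal (4 * M') ^ (1 / 2 : ℝ) := by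
    intro k
    rw [eLpNorm_eq_lintegral_rpow_enorm_toReal two_ne_zero ENNReal.ofNat_ne_top]
    simp only [ENNReal.toReal_ofNat, ENNReal.rpow_ofNat]
    exact ENNReal.rpow_le_rpow (hWlin k) (by norm_num)
  have hWmem : ∀ k, MemLp (W k) 2 volume := fun k =>
    ⟨hWm k, (hWnorm k).trans_lt (ENNReal.rpow_lt_top_of_nonneg (by norm_num) ENNReal.ofReal_ne_top)⟩
  set Mw : ℝ := (ENNReal.ofReal (4 * M') ^ (1 / 2 : ℝ)).toReal with hMw
  haveI : Fact ((2 : ℝ≥0∞) ≠ (⊤ : ℝ≥0∞)) := ⟨ENNReal.ofNat_ne_top⟩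
  set w : ℕ → Lp (EuclideanSpace ℝ (Fin 3)) 2 (volume : Measure (EuclideanSpace ℝ (Fin 3))) :=
    fun k => (hWmem k).toLp (W k) with hw
  have hwM : ∀ k, ‖w k‖ ≤ Mw := fun k => by
    rw [hw, Lp.norm_toLp, hMw]
    exact ENNReal.toReal_mono (ENNReal.rpow_ne_top_of_nonneg (by norm_num) ENNReal.ofReal_ne_top) (hWnorm k)
  -- weak limit along a subsequence
  obtain ⟨ψ, hψ, wl, -, hweak⟩ := FunctionSpaces.exists_strictMono_tendsto_inner_of_norm_le hwM
  have hwlmem : MemLp (wl : EuclideanSpace ℝ (Fin 3) → EuclideanSpace ℝ (Fin 3)) 2 volume := Lp.memLp wl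
  set g : EuclideanSpace ℝ (Fin 3) → EuclideanSpace ℝ (Fin 3) :=
    fun y => ((1 + ‖y‖ ^ 2) : ℝ) • (wl : EuclideanSpace ℝ (Fin 3) → EuclideanSpace ℝ (Fin 3)) y with hg
  have hgW : (fun y => ((1 + ‖y‖ ^ 2)⁻¹ : ℝ) • g y) =
      (wl : EuclideanSpace ℝ (Fin 3) → EuclideanSpace ℝ (Fin 3)) := by
    funext y
    simp only [hg, smul_smul]
    rw [inv_mul_cancel₀ (by positivity : (1 + ‖y‖ ^ 2 : ℝ) ≠ 0), one_smul]
  have hgWmem : MemLp (fun y => ((1 + ‖y‖ ^ 2)⁻¹ : ℝ) • g y) 2 volume := by rw [hgW]; exact hwlmem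
  have hweak' : ∀ z : Lp (EuclideanSpace ℝ (Fin 3)) 2 (volume : Measure (EuclideanSpace ℝ (Fin 3))),
      Tendsto (fun k => ⟪(hWmem (ψ k)).toLp _, z⟫) atTop (𝓝 ⟪hgWmem.toLp _, z⟫) := by
    intro z
    have e : hgWmem.toLp _ = wl := by
      have : hgWmem.toLp (fun y => ((1 + ‖y‖ ^ 2)⁻¹ : ℝ) • g y) = hwlmem.toLp _ := by congr 1
      rw [this]
      exact Lp.toLp_coeFn wl hwlmem
    rw [e]
    exact hweak z
  have hpair : ∀ {ζ : EuclideanSpace ℝ (Fin 3) → EuclideanSpace ℝ (Fin 3)}, MemLp ζ 2 volume → ∀ {a : ℝ},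
      (∀ y, y ∉ ball (0 : EuclideanSpace ℝ (Fin 3)) a → ζ y = 0) →
      Tendsto (fun k => ∫ y, ⟪V (ψ k) y, ζ y⟫) atTop (𝓝 (∫ y, ⟪g y, ζ y⟫)) :=
    fun hζ a hsupp => SereginSverak2002.tendsto_integral_inner_of_weak (V := fun k => V (ψ k))
      (fun k => hWmem (ψ k)) hgWmem hweak' hζ hsupp
  -- local integrability of `g`
  have hgm : AEStronglyMeasurable g volume :=
    (continuous_const.add (continuous_norm.pow 2)).aestronglyMeasurable.smul hwlmem.aestronglyMeasurable
  have hgbound : ∀ {a : ℝ} (y : EuclideanSpace ℝ (Fin 3)), y ∈ ball (0 : EuclideanSpace ℝ (Fin 3)) a →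
      ‖g y‖ ≤ (1 + a ^ 2) * ‖(wl : EuclideanSpace ℝ (Fin 3) → EuclideanSpace ℝ (Fin 3)) y‖ := by
    intro a y hy
    simp only [hg, norm_smul, Real.norm_eq_abs, abs_of_nonneg (by positivity : (0 : ℝ) ≤ 1 + ‖y‖ ^ 2)]
    refine mul_le_mul_of_nonneg_right ?_ (norm_nonneg _)
    have : ‖y‖ < a := mem_ball_zero_iff.1 hy
    nlinarith [norm_nonneg y]
  have hwlL2 : Integrable fun y => ‖(wl : EuclideanSpace ℝ (Fin 3) → EuclideanSpace ℝ (Fin 3)) y‖ ^ 2 :=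
    hwlmem.integrable_norm_pow two_ne_zero
  have hg2 : ∀ a : ℝ, IntegrableOn (fun y => ‖g y‖ ^ 2) (ball (0 : EuclideanSpace ℝ (Fin 3)) a) := by
    intro a
    refine Integrable.mono' ((hwlL2.const_mul ((1 + a ^ 2) ^ 2)).integrableOn)
      ((hgm.norm.pow 2).restrict) ?_
    filter_upwards [ae_restrict_mem measurableSet_ball] with y hy
    rw [Real.norm_eq_abs, abs_of_nonneg (sq_nonneg _)]
    calc ‖g y‖ ^ 2 ≤ ((1 + a ^ 2) * ‖(wl : EuclideanSpace ℝ (Fin 3) → EuclideanSpace ℝ (Fin 3)) y‖) ^ 2 :=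
          pow_le_pow_left₀ (norm_nonneg _) (hgbound y hy) 2
      _ = (1 + a ^ 2) ^ 2 * ‖(wl : EuclideanSpace ℝ (Fin 3) → EuclideanSpace ℝ (Fin 3)) y‖ ^ 2 := by ring
  have hgloc : LocallyIntegrable g volume := by
    refine (locallyIntegrable_iff.2 fun K hK => ?_)
    have hwlK : IntegrableOn (wl : EuclideanSpace ℝ (Fin 3) → EuclideanSpace ℝ (Fin 3)) K :=
      (hwlmem.locallyIntegrable (by norm_num)).integrableOn_isCompact hK
    exact hwlK.continuousOn_smul (continuous_const.add (continuous_norm.pow 2)).continuousOn hK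
  refine ⟨ψ, g, hψ, hgloc, hg2, fun ζ hζ a hsupp => ?_⟩
  -- the truncation is invisible for `k` large: `e^{φ (ψ k)} ≥ a` eventually
  have hev : ∀ᶠ k in atTop, a ≤ Real.exp (φ (ψ k) : ℕ) := by
    have h1 : Tendsto (fun k : ℕ => Real.exp (φ (ψ k) : ℕ)) atTop atTop :=
      Real.tendsto_exp_atTop.comp (tendsto_natCast_atTop_atTop.comp
        ((hφ.comp hψ).tendsto_atTop))
    exact h1.eventually_ge_atTop a
  refine (hpair hζ hsupp).congr' ?_
  filter_upwards [hev] with k hk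
  refine integral_congr_ae (Eventually.of_forall fun y => ?_)
  by_cases hy : y ∈ ball (0 : EuclideanSpace ℝ (Fin 3)) a
  · have hy' : y ∈ ball (0 : EuclideanSpace ℝ (Fin 3)) (Real.exp (φ (ψ k) : ℕ)) :=
      ball_subset_ball hk hy
    simp only [hV, indicator_of_mem hy', hv0]
  · simp only [hsupp y hy, inner_zero_right]

end Summit.NavierStokesRegularity.NavierStokesRegularity.Theorems.ThinCascade

end
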